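import Mathlib
import Literature.MathematicalPhysics.QuantumLattice.GrassmannGaussianQuadraticInsertionTwoLeg
import Literature.MathematicalPhysics.QuantumLattice.HubbardQuadraticShift
import Literature.MathematicalPhysics.QuantumLattice.HubbardCovarianceFrameResolvent
import Literature.MathematicalPhysics.QuantumLattice.SymmetricRegimeFunctionals

/-!
# The counterterm vertex resummed: the self-energy of `effAction C (V + 𝒩_K)` for a NORMAL covariance `C` is the K-chain plus
# the dressed self-energy of `effAction C̃ V`, `C̃` the resummed normal covariance

Topic `Literature/MathematicalPhysics/QuantumLattice`; the model-level instance of `GrassmannGaussianQuadraticInsertionTwoLeg`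
(cell gate-hubbard-kl, K3 engine two-leg lane: the «K-resummed representation» removing the counterterm vertex from the expansion —
Feldman–Salmhofer–Trubowitz 1996 §1: «the counterterm `K` as an extra interaction vertex» versus «`E = e + K` in the propagator»;
Benfatto–Giuliani–Mastropietro 2006 (2.21)–(2.24): renormalisation of the free measure).  For a normal charged covariance
`C = normalCovariance p` (momentum/spin diagonal, pairing `ψ⁺` with `ψ⁻`; e.g. the CT cutoff covariance `C^K_{>Λ}` at seed `0`,
`hubbardCovAboveCT_zero_seed`) and the quadratic counterterm `𝒩_K = Σ_{kσ} κ_k ψ̂⁺_{kσ}ψ̂⁻_{kσ}`, `κ_k = K(p_k⃗)/(βL²)`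
(`counterQuadratic`), everything in the two-leg identity is DIAGONAL per `(k,σ)`:

* `C·S = diagonal (p·κ)`, so `M = diagonal ((1 + p·κ)⁻¹)` solves `M(1 + CS) = 1` and the renormalised covariance is again normal,
  `M·C = normalCovariance p̃`, **`p̃ = p/(1 + p·κ)`** (`counterS_eq_normalCovariance`, `diagonal_mul_one_add_normalCovariance_mul_normalCovariance_neg`,
  with `HubbardQuadraticShift`'s normal-form algebra and `HubbardCovarianceFrameResolvent.neg_counterQuadratic_eq_sum`);
* **`selfEnergy_effAction_add_counterQuadratic`** — for every even `V` without constant part, every symbol `p` with `1 + p·κ ≠ 0` and unit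
  total partition function: `Σ_{C,V+𝒩_K}(k,σ) = βL²κ_k − βL²κ_k²·p̃(k,σ) + (1 − κ_k·p̃(k,σ))²·Σ_{C̃,V}(k,σ)`, `C̃ = normalCovariance p̃` —
  the chain `K + K²Φ̃ ` of the counterterm through the resummed line plus the self-energy of the PURELY non-quadratic theory with the
  resummed covariance, dressed on both legs by `T = 1 − κ p̃`;
* **`selfEnergy_effAction_add_counterQuadratic_of_symbol_eq_zero`** — where the symbol vanishes (`p(k,σ) = 0`: the cutoff shell's
  zero set, e.g. the tube around the Fermi curve at the lowest frequencies), `p̃ = 0`, `T = 1` and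
  `Σ_{C,V+𝒩_K}(k,σ) = βL²κ_k + Σ_{C̃,V}(k,σ)` EXACTLY: off that set the chain is present, on it it is not.

Everything is proved; no definitions (the resummed symbol is written out); no named facts.

## Sources

J. Feldman, M. Salmhofer, E. Trubowitz, J. Stat. Phys. 84 (1996) 1209–1336, §1 [`FeldmanSalmhoferTrubowitz1996`];
G. Benfatto, A. Giuliani, V. Mastropietro, Ann. Henri Poincaré 7 (2006) 809–898, §2.1 (2.3), (2.21)–(2.24) [`BenfattoGiulianiMastropietro2006`].
-/

noncomputable section

namespace Literature.MathematicalPhysics.QuantumLattice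

open GrassmannAlgebra Finset Literature.Probability.LatticeModels

variable {L M : ℕ} [NeZero L]

/-! ### The antisymmetrised counterterm matrix is a normal-form matrix; everything is diagonal per `(k,σ)` -/

section Diagonal

variable (p : FreqMomentum L M × Fin 2 → ℂ) (κ : FreqMomentum L M × Fin 2 → ℂ)

omit [NeZero L] in
/-- **`S = N − Nᵀ` is the normal-form matrix of the symbol `−κ`** for `N` supported on `(ψ⁺_{kσ}, ψ⁻_{kσ})` with value `−κ`
(the shape of `neg_counterQuadratic_eq_sum`). [cite: BenfattoGiulianiMastropietro2006, (2.21)–(2.24)] -/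
theorem counterS_eq_normalCovariance :
    (Matrix.of fun X Z : HubbardFieldIdx L M =>
        (Matrix.of fun Z W : HubbardFieldIdx L M => if Z.2 = 0 ∧ W = (Z.1, 1) then -κ Z.1 else 0) X Z -
          (Matrix.of fun Z W : HubbardFieldIdx L M => if Z.2 = 0 ∧ W = (Z.1, 1) then -κ Z.1 else 0) Z X) =
      normalCovariance L M fun ks => -κ ks := by
  ext X Z
  rw [Matrix.of_apply, Matrix.of_apply, Matrix.of_apply, normalCovariance_apply]
  obtain ⟨ks, c⟩ := X
  obtain ⟨ks', c'⟩ := Z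
  by_cases h : ks = ks'
  · subst h
    fin_cases c <;> fin_cases c' <;> simp
  · have h1 : ¬((ks, c).2 = 0 ∧ ((ks', c') : HubbardFieldIdx L M) = ((ks, c).1, 1)) := fun hh => h (congrArg Prod.fst hh.2).symm
    have h2 : ¬((ks', c').2 = 0 ∧ ((ks, c) : HubbardFieldIdx L M) = ((ks', c').1, 1)) := fun hh => h (congrArg Prod.fst hh.2)
    rw [if_neg h1, if_neg h2, if_neg h, sub_zero]

/-- **The resummation matrix**: with `m = (1 + p·κ)⁻¹` (all `1 + pκ ≠ 0`), `diagonal m · (1 + C·S) = 1` for `C = normalCovariance p`,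
`S = normalCovariance (−κ)` (`C·S = diagonal (p·κ)`). [cite: BenfattoGiulianiMastropietro2006, (2.21)–(2.24)] -/
theorem diagonal_mul_one_add_normalCovariance_mul_normalCovariance_neg (hden : ∀ ks, 1 + p ks * κ ks ≠ 0) :
    Matrix.diagonal (fun X : HubbardFieldIdx L M => (1 + p X.1 * κ X.1)⁻¹) *
        (1 + normalCovariance L M p * normalCovariance L M fun ks => -κ ks) = 1 := by
  have hCS : normalCovariance L M p * normalCovariance L M (fun ks => -κ ks) =
      Matrix.diagonal fun X : HubbardFieldIdx L M => p X.1 * κ X.1 := by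
    rw [normalCovariance_mul_normalCovariance]
    ext X Y
    rw [Matrix.neg_apply, Matrix.diagonal_apply, Matrix.diagonal_apply]
    split_ifs <;> ring
  rw [hCS, ← Matrix.diagonal_one, Matrix.diagonal_add, Matrix.diagonal_mul_diagonal]
  congr 1
  funext X
  exact inv_mul_cancel₀ (hden X.1)

end Diagonal

/-! ### The self-energy -/

omit [NeZero L] in
/-- The normal self-energy is `βL²` times the quadratic coefficient `constPart(∂_{ψ⁻_{kσ}} ∂_{ψ⁺_{kσ}} G)`. [cite: Salmhofer1998, §2.5] -/
theorem selfEnergy_eq_constPart (β : ℝ) (G : HubbardGrassmann L M) (k : FreqMomentum L M) (σ : Fin 2) :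
    selfEnergy L M β G k σ =
      ((β * (L : ℝ) ^ 2 : ℝ) : ℂ) * constPart ℂ (grassmannDeriv ℂ (((k, σ), 1) : HubbardFieldIdx L M)
        (grassmannDeriv ℂ (((k, σ), 0) : HubbardFieldIdx L M) G)) := by
  rw [selfEnergy, vertexFn_def, kernel_def]
  have hiter : iterDeriv ℂ (![((k, σ), 0), ((k, σ), 1)] : Fin 2 → HubbardFieldIdx L M) =
      grassmannDeriv ℂ (((k, σ), 1) : HubbardFieldIdx L M) * grassmannDeriv ℂ (((k, σ), 0) : HubbardFieldIdx L M) := by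
    simp [iterDeriv, List.ofFn_succ]
  rw [hiter, Module.End.mul_apply]
  simp only [Nat.factorial_two, Nat.cast_ofNat]
  rw [← mul_assoc]
  congr 1
  rw [show ((2 : ℚ)⁻¹ • (1 : ℂ)) = (2 : ℂ)⁻¹ by rw [Rat.smul_one_eq_cast]; push_cast; ring]
  push_cast
  ring

section Main

variable (p : FreqMomentum L M × Fin 2 → ℂ) {V : HubbardGrassmann L M} (hV : V ∈ evenPart ℂ (HubbardFieldIdx L M))
  (hV0 : constPart ℂ V = 0) (β : ℝ) (K : TrigPolyC4v)
  (hden : ∀ ks : FreqMomentum L M × Fin 2, 1 + p ks * ((K.eval (latticeMomentum L ks.1.2) / (β * (L : ℝ) ^ 2) : ℝ) : ℂ) ≠ 0)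
  (hZ : IsUnit (effPartitionFn ℂ (normalCovariance L M p) (V + counterQuadratic L M β K)))

include hV hV0 hden hZ

/-- **The counterterm vertex resummed at the self-energy.**  `C = normalCovariance p`, `κ_k = K(p_k⃗)/(βL²)`, `p̃ = p/(1 + pκ)`,
`C̃ = normalCovariance p̃`; for every even `V` without constant part and unit total partition function:
`Σ_{C, V+𝒩_K}(k,σ) = βL²·κ_k − βL²·κ_k²·p̃(k,σ) + (1 − κ_k·p̃(k,σ))²·Σ_{C̃, V}(k,σ)`.
[cite: FeldmanSalmhoferTrubowitz1996, §1] -/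
theorem selfEnergy_effAction_add_counterQuadratic (k : FreqMomentum L M) (σ : Fin 2) :
    selfEnergy L M β (effAction ℂ (normalCovariance L M p) (V + counterQuadratic L M β K)) k σ =
      ((β * (L : ℝ) ^ 2 : ℝ) : ℂ) * ((K.eval (latticeMomentum L k.2) / (β * (L : ℝ) ^ 2) : ℝ) : ℂ) -
        ((β * (L : ℝ) ^ 2 : ℝ) : ℂ) * ((K.eval (latticeMomentum L k.2) / (β * (L : ℝ) ^ 2) : ℝ) : ℂ) ^ 2 *
          (p (k, σ) / (1 + p (k, σ) * ((K.eval (latticeMomentum L k.2) / (β * (L : ℝ) ^ 2) : ℝ) : ℂ))) +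
        (1 - ((K.eval (latticeMomentum L k.2) / (β * (L : ℝ) ^ 2) : ℝ) : ℂ) *
            (p (k, σ) / (1 + p (k, σ) * ((K.eval (latticeMomentum L k.2) / (β * (L : ℝ) ^ 2) : ℝ) : ℂ)))) ^ 2 *
          selfEnergy L M β (effAction ℂ (normalCovariance L M fun ks =>
            p ks / (1 + p ks * ((K.eval (latticeMomentum L ks.1.2) / (β * (L : ℝ) ^ 2) : ℝ) : ℂ))) V) k σ := by
  -- names
  set κ : FreqMomentum L M × Fin 2 → ℂ := fun ks => ((K.eval (latticeMomentum L ks.1.2) / (β * (L : ℝ) ^ 2) : ℝ) : ℂ) with hκ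
  set N : Matrix (HubbardFieldIdx L M) (HubbardFieldIdx L M) ℂ :=
    Matrix.of fun Z W : HubbardFieldIdx L M => if Z.2 = 0 ∧ W = (Z.1, 1) then -κ Z.1 else 0 with hN
  set q : HubbardGrassmann L M := -counterQuadratic L M β K with hqdef
  have hq : q = ∑ X, ∑ Y, N X Y • (gen ℂ X * gen ℂ Y) := by
    rw [hqdef, hN, hκ]
    exact neg_counterQuadratic_eq_sum L M β K
  set C := normalCovariance L M p with hCdef
  set S : Matrix (HubbardFieldIdx L M) (HubbardFieldIdx L M) ℂ := Matrix.of fun X Y => N X Y - N Y X with hSdef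
  have hS : S = Matrix.of fun X Y => N X Y - N Y X := rfl
  have hSnc : S = normalCovariance L M fun ks => -κ ks := by
    rw [hSdef, hN]; exact counterS_eq_normalCovariance κ
  have hC : C.transpose = -C := normalCovariance_transpose p
  set m : FreqMomentum L M × Fin 2 → ℂ := fun ks => (1 + p ks * κ ks)⁻¹ with hm
  set Mx : Matrix (HubbardFieldIdx L M) (HubbardFieldIdx L M) ℂ := Matrix.diagonal fun X => m X.1 with hMx
  have hM : Mx * (1 + C * S) = 1 := by
    rw [hMx, hCdef, hSnc]
    exact diagonal_mul_one_add_normalCovariance_mul_normalCovariance_neg p κ hden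
  set p' : FreqMomentum L M × Fin 2 → ℂ := fun ks => p ks / (1 + p ks * κ ks) with hp'
  have hMC : Mx * C = normalCovariance L M p' := by
    rw [hMx, hCdef, diagonal_mul_normalCovariance]
    congr 1
    funext ks
    rw [hp', hm]
    simp only
    rw [div_eq_mul_inv, mul_comm]
  -- the total interaction is `V - q`
  have hVq : V + counterQuadratic L M β K = V - q := by rw [hqdef, sub_neg_eq_add]
  -- partition functions
  have hZtot : effPartitionFn ℂ C (V - q) = gaussExpect ℂ C (grassmannExp q) * effPartitionFn ℂ (Mx * C) V :=
    effPartitionFn_sub_of_transpose_eq_neg N hq hC hS hM hV0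
  have hZ2 : IsUnit (effPartitionFn ℂ C (V - q)) := by rw [← hVq]; exact hZ
  rw [hZtot] at hZ2
  have hZq : IsUnit (gaussExpect ℂ C (grassmannExp q)) := isUnit_of_mul_isUnit_left hZ2
  have hZ' : IsUnit (effPartitionFn ℂ (Mx * C) V) := isUnit_of_mul_isUnit_right hZ2
  -- the generic two-leg identity at `X = ψ⁻_{kσ}`, `Y = ψ⁺_{kσ}`
  have key := constPart_deriv_deriv_effAction_sub_quadratic N hq hC hS hM hV hV0 hZ' hZq
    (((k, σ), 1) : HubbardFieldIdx L M) (((k, σ), 0) : HubbardFieldIdx L M)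
  -- explicit entries of `S` and of the renormalised pair function
  have hSX : ∀ Z : HubbardFieldIdx L M, S ((k, σ), 1) Z = if Z = ((k, σ), 0) then κ (k, σ) else 0 := by
    intro Z
    rw [hSnc, normalCovariance_apply]
    obtain ⟨ks, c⟩ := Z
    by_cases h : ks = (k, σ)
    · subst h; fin_cases c <;> simp
    · have : ¬(((ks, c) : HubbardFieldIdx L M) = ((k, σ), 0)) := fun hh => h (congrArg Prod.fst hh)
      simp [Ne.symm h, this]
  have hSY : ∀ Z : HubbardFieldIdx L M, S ((k, σ), 0) Z = if Z = ((k, σ), 1) then -κ (k, σ) else 0 := by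
    intro Z
    rw [hSnc, normalCovariance_apply]
    obtain ⟨ks, c⟩ := Z
    by_cases h : ks = (k, σ)
    · subst h; fin_cases c <;> simp
    · have : ¬(((ks, c) : HubbardFieldIdx L M) = ((k, σ), 1)) := fun hh => h (congrArg Prod.fst hh)
      simp [Ne.symm h, this]
  have hAY : ∀ U : HubbardFieldIdx L M, ((1 / 2 : ℚ) • (1 : ℂ)) * ((Mx * C) U ((k, σ), 0) - (Mx * C) ((k, σ), 0) U) =
      if U = ((k, σ), 1) then -p' (k, σ) else 0 := by
    intro U
    rw [hMC, normalCovariance_apply, normalCovariance_apply]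
    obtain ⟨ks, c⟩ := U
    by_cases h : ks = (k, σ)
    · subst h
      fin_cases c <;> simp
      ring
    · have : ¬(((ks, c) : HubbardFieldIdx L M) = ((k, σ), 1)) := fun hh => h (congrArg Prod.fst hh)
      simp [h, Ne.symm h, this]
  have hAX : ∀ U : HubbardFieldIdx L M, ((1 / 2 : ℚ) • (1 : ℂ)) * ((Mx * C) U ((k, σ), 1) - (Mx * C) ((k, σ), 1) U) =
      if U = ((k, σ), 0) then p' (k, σ) else 0 := by
    intro U
    rw [hMC, normalCovariance_apply, normalCovariance_apply]
    obtain ⟨ks, c⟩ := U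
    by_cases h : ks = (k, σ)
    · subst h
      fin_cases c <;> simp
      ring
    · have : ¬(((ks, c) : HubbardFieldIdx L M) = ((k, σ), 0)) := fun hh => h (congrArg Prod.fst hh)
      simp [h, Ne.symm h, this]
  -- antisymmetry of the quadratic coefficient
  have hDanti : constPart ℂ (grassmannDeriv ℂ (((k, σ), 0) : HubbardFieldIdx L M)
      (grassmannDeriv ℂ (((k, σ), 1) : HubbardFieldIdx L M) (effAction ℂ (Mx * C) V))) =
      -constPart ℂ (grassmannDeriv ℂ (((k, σ), 1) : HubbardFieldIdx L M)
        (grassmannDeriv ℂ (((k, σ), 0) : HubbardFieldIdx L M) (effAction ℂ (Mx * C) V))) := by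
    rw [grassmannDeriv_grassmannDeriv_comm, map_neg]
  -- collapse the sums
  simp only [hSX, hSY, ite_mul, zero_mul, mul_ite, mul_zero, Finset.sum_ite_eq', Finset.sum_ite_irrel,
    Finset.sum_const_zero, Finset.mem_univ, if_true] at key
  simp only [hAY, hAX, ite_mul, zero_mul, mul_ite, mul_zero, Finset.sum_ite_eq', Finset.mem_univ, if_true, hDanti] at key
  -- rewrite both self-energies through `constPart ∂∂`
  rw [hVq, selfEnergy_eq_constPart, selfEnergy_eq_constPart, ← hMC, key]
  simp only [hp']
  ring

/-- **On the zero set of the symbol the chain is absent**: if `p(k,σ) = 0` then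
`Σ_{C, V+𝒩_K}(k,σ) = βL²·κ_k + Σ_{C̃, V}(k,σ)` exactly. [cite: FeldmanSalmhoferTrubowitz1996, §1] -/
theorem selfEnergy_effAction_add_counterQuadratic_of_symbol_eq_zero (k : FreqMomentum L M) (σ : Fin 2) (hk : p (k, σ) = 0) :
    selfEnergy L M β (effAction ℂ (normalCovariance L M p) (V + counterQuadratic L M β K)) k σ =
      ((β * (L : ℝ) ^ 2 : ℝ) : ℂ) * ((K.eval (latticeMomentum L k.2) / (β * (L : ℝ) ^ 2) : ℝ) : ℂ) +
        selfEnergy L M β (effAction ℂ (normalCovariance L M fun ks =>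
          p ks / (1 + p ks * ((K.eval (latticeMomentum L ks.1.2) / (β * (L : ℝ) ^ 2) : ℝ) : ℂ))) V) k σ := by
  rw [selfEnergy_effAction_add_counterQuadratic p hV hV0 β K hden hZ k σ, hk]
  ring

end Main

end Literature.MathematicalPhysics.QuantumLattice

end
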